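import Literature.NumberTheory.NumberFields.RingClassFieldOfConductor
import Literature.NumberTheory.QuadraticFields.RingClassNumber
import Literature.NumberTheory.ComplexMultiplication.CMLatticeRingClassTowerKernelUnitsQuotient
import HarnessLib

/-!
# The order of a prime class in the ring class group of PRIME conductor `ℓ`, `ℓ` inert
# (Cox, *Primes of the form x² + ny²*, §7.D (7.27); Gross 1991, §3)

Topic `NumberTheory/QuadraticFields`, namespace `Literature.NumberTheory.QuadraticFields.RingClass`
(continuing `RingClassGroup.lean`, `RingClassNumber.lean`). Theorems only — no definition, no named fact.

Let `K` be an imaginary quadratic field with `d_K < -4` (so `𝓞_K^× = {±1}`), `ℓ` a rational prime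
INERT in `K` (`ℓ𝓞_K` prime, residue field `𝓞_K/ℓ ≅ 𝔽_{ℓ²}`), and `𝔭 = 𝔭_v` a prime of `K` not
dividing `ℓ` with `𝔭^h = (β)` principal. Cox's exact sequence (7.27)
`1 → (ℤ/ℓ)^× · 𝓞_K^× → (𝓞_K/ℓ)^× →θ I_K(ℓ)/P_{K,ℤ}(ℓ) → Cl(𝓞_K) → 1` gives `[𝔭]^h = θ(β mod ℓ)`,
so `[𝔭]^{hn} = 1` iff `β^n ≡ ± a (mod ℓ𝓞_K)` for an integer `a` prime to `ℓ`; with Fermat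
(`a^{ℓ-1} ≡ 1`) and `#(𝓞_K/ℓ)^× = ℓ² - 1` this yields the divisibility used by the
auxiliary-norm argument on Heegner points (Gross 1991, §3: `G_ℓ ≅ (𝓞_K/ℓ)^×/(ℤ/ℓ)^×` is cyclic of
order `ℓ + 1`):

* `primeClass_pow_eq_mk_prin` — `[𝔭_v]^h = [β𝓞_K]` when `𝔭_v^h = (β)` (any number field, any `f`);
* `exists_pow_sub_intCast_mem_of_primeClass_pow_eq_one` — for quadratic `K` and `f ≥ 2`:
  `[𝔭_v]^{h·n} = 1 ⟹ β^n ≡ ε·a (mod f𝓞_K)`, `ε ∈ 𝓞_K^×`, `a ∈ ℤ` prime to `f`;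
* `pow_sub_one_mem_span_of_inert` — `β^{ℓ²-1} ≡ 1 (mod ℓ𝓞_K)` for `β` prime to the inert `ℓ`;
* **`pow_dvd_orderOf_primeClass_of_inert`** — if `p^E ∣ ℓ + 1`, `p ∤ ℓ - 1` and
  `β^{(ℓ²-1)/p} ≢ 1 (mod ℓ𝓞_K)` (`β` is not a `p`-th power in `𝔽_{ℓ²}^×`), then
  `p^E ∣ orderOf [𝔭_v]` in `I_K(ℓ)/P_{K,ℤ}(ℓ)`.

## References

* D. A. Cox, *Primes of the form x² + ny²*, 2nd ed., Wiley (2013), §7.D, (7.25)–(7.27), Thm. 7.24.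
  [Cox2013]
* B. H. Gross, *Kolyvagin's work on modular elliptic curves*, in *L-functions and arithmetic*, LMS
  Lecture Note Ser. 153 (1991), §3 (p. 239). [GrossLMS1991]

## Mathlib / tree search

Tree: `RingClassField.primeClass`, `idealClass`, `idealClass_eq`, `prin`, `prin_eq_mk0`, `theta_eq`,
`theta_eq_one_iff`, `isUnit_mk_of_sup_eq_top`, `exists_basis_zero_eq_one`, `basis_one_mul_self_eq`,
`intCast_mem_span_iff`, `CMTypeLattice.units_eq_one_or_eq_neg_one_of_discr_lt`. Mathlib:
`Int.ModEq.pow_card_sub_one_eq_one`, `Ideal.Quotient.field`, `FiniteField.pow_card_sub_one_eq_one`,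
`Ideal.absNorm_span_singleton`, `Algebra.norm_algebraMap`, `orderOf_dvd_of_pow_eq_one`,
`Nat.Coprime.dvd_of_dvd_mul_right`.
-/

noncomputable section

open scoped nonZeroDivisors NumberField
open Module NumberField IsDedekindDomain

namespace Literature.NumberTheory.QuadraticFields.RingClass

open Literature.NumberTheory.NumberFields.RingClassField
open Literature.NumberTheory.QuadraticFields.Quadratic
open Literature.NumberTheory.ComplexMultiplication

variable {K : Type} [Field K] [NumberField K]

/-! ### `[𝔭]^h = [β]` when `𝔭^h = (β)` -/

omit [NumberField K] in
/-- A generator of `𝔭^h` is non-zero. [folklore] -/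
private theorem ne_zero_of_pow_eq_span {v : HeightOneSpectrum (𝓞 K)} {h : ℕ} {β : 𝓞 K}
    (hβ : v.asIdeal ^ h = Ideal.span {β}) : β ≠ 0 := by
  intro h0
  refine pow_ne_zero h v.ne_bot ?_
  rw [hβ, h0]
  exact Ideal.span_singleton_eq_bot.mpr rfl

omit [NumberField K] in
/-- `(β) = 𝔭^h` is prime to `f` when `𝔭` is. [cite: Cox2013, §7.C (ideals prime to f)] -/
theorem span_sup_eq_top_of_pow_eq_span {f : ℕ} {v : HeightOneSpectrum (𝓞 K)}
    (hv : v.asIdeal ⊔ Ideal.span {(f : 𝓞 K)} = ⊤) {h : ℕ} {β : 𝓞 K}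
    (hβ : v.asIdeal ^ h = Ideal.span {β}) :
    Ideal.span {β} ⊔ Ideal.span {(f : 𝓞 K)} = ⊤ := by
  rw [← hβ]
  exact Ideal.pow_sup_eq_top hv

/-- **`[𝔭_v]^h = [β𝓞_K]` in `I_K(f)/P_{K,ℤ}(f)` when `𝔭_v^h = (β)`** (`𝔭_v ∤ f`): the class map
`𝔞 ↦ [𝔞]` is multiplicative on ideals prime to `f`. [cite: Cox2013, §7.C Prop. 7.20, Prop. 7.22] -/
theorem primeClass_pow_eq_mk_prin (f : ℕ) {v : HeightOneSpectrum (𝓞 K)}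
    (hv : v.asIdeal ⊔ Ideal.span {(f : 𝓞 K)} = ⊤) {h : ℕ} {β : 𝓞 K}
    (hβ : v.asIdeal ^ h = Ideal.span {β}) :
    primeClass f v ^ h =
      QuotientGroup.mk ⟨prin K β (ne_zero_of_pow_eq_span hβ),
        prin_mem_ringClassNum _ (span_sup_eq_top_of_pow_eq_span hv hβ)⟩ := by
  rw [primeClass_of_sup_eq_top f hv, idealClass_eq, ← QuotientGroup.mk_pow]
  congr 1
  apply Subtype.ext
  show (FractionalIdeal.mk0 K ⟨v.asIdeal, mem_nonZeroDivisors_of_ne_bot v.ne_bot⟩) ^ h =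
    prin K β (ne_zero_of_pow_eq_span hβ)
  rw [prin_eq_mk0, ← map_pow]
  congr 1
  apply Subtype.ext
  rw [SubmonoidClass.coe_pow]
  exact hβ

/-! ### `[𝔭]^{hn} = 1` forces `β^n ≡ ε a (mod f)` (quadratic `K`) -/

/-- **`[𝔭_v]^{h·n} = 1 ⟹ β^n ≡ ε·a (mod f𝓞_K)`** for a quadratic field `K`, `f ≥ 2`, `𝔭_v ∤ f`,
`𝔭_v^h = (β)`: by `primeClass_pow_eq_mk_prin`, `[𝔭_v]^{hn} = [β^n 𝓞_K] = θ(β^n mod f)`, and the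
kernel of Cox's `θ : (𝓞_K/f)^× → I_K(f)/P_{K,ℤ}(f)` is `(ℤ/f)^× · 𝓞_K^×` (`theta_eq_one_iff`).
[cite: Cox2013, §7.D (7.27)] -/
theorem exists_pow_sub_intCast_mem_of_primeClass_pow_eq_one (h2 : finrank ℚ K = 2) {f : ℕ}
    (hf : 2 ≤ f) {v : HeightOneSpectrum (𝓞 K)} (hv : v.asIdeal ⊔ Ideal.span {(f : 𝓞 K)} = ⊤)
    {h : ℕ} {β : 𝓞 K} (hβ : v.asIdeal ^ h = Ideal.span {β}) {n : ℕ}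
    (hn : primeClass f v ^ (h * n) = 1) :
    ∃ ε : (𝓞 K)ˣ, ∃ a : ℤ, IsCoprime a (f : ℤ) ∧
      β ^ n - (ε : 𝓞 K) * (a : 𝓞 K) ∈ Ideal.span {(f : 𝓞 K)} := by
  classical
  obtain ⟨b, hb⟩ := exists_basis_zero_eq_one (K := K) h2
  have hω := basis_one_mul_self_eq b hb
  have hf' : Ideal.span {(f : 𝓞 K)} ≠ ⊤ := by
    intro htop
    have h1 : ((1 : ℤ) : 𝓞 K) ∈ Ideal.span {(f : 𝓞 K)} := by rw [htop]; exact Submodule.mem_top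
    rw [intCast_mem_span_iff b hb] at h1
    have : (f : ℤ) ≤ 1 := Int.le_of_dvd one_pos h1
    omega
  -- the unit `x = β mod f`
  have hβu : IsUnit (Ideal.Quotient.mk (Ideal.span {(f : 𝓞 K)}) β) :=
    isUnit_mk_of_sup_eq_top (span_sup_eq_top_of_pow_eq_span hv hβ)
  set x := hβu.unit with hx
  have hxβ : Ideal.Quotient.mk (Ideal.span {(f : 𝓞 K)}) β = x := hβu.unit_spec.symm
  -- `θ x = [β] = [𝔭]^h`
  have hθ : theta K f b hb hω hf' x = primeClass f v ^ h := by
    rw [theta_eq b hb hω hf' hxβ, primeClass_pow_eq_mk_prin f hv hβ]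
  -- `θ (x^n) = [𝔭]^{hn} = 1`
  have hθn : theta K f b hb hω hf' (x ^ n) = 1 := by rw [map_pow, hθ, ← pow_mul, hn]
  obtain ⟨ε, a, ha, hxa⟩ := (theta_eq_one_iff b hb hω hf' (x ^ n)).mp hθn
  refine ⟨ε, a, ha, ?_⟩
  rw [← Ideal.Quotient.eq, map_pow, hxβ, ← Units.val_pow_eq_pow_val, hxa]

/-! ### The residue field at an inert prime: `β^{ℓ² - 1} ≡ 1 (mod ℓ)` -/

/-- The norm of the ideal `ℓ𝓞_K` is `ℓ^{[K:ℚ]}`. [folklore] -/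
private theorem absNorm_span_natCast_eq_pow (ℓ : ℕ) :
    Ideal.absNorm (Ideal.span {(ℓ : 𝓞 K)}) = ℓ ^ finrank ℚ K := by
  rw [Ideal.absNorm_span_singleton]
  have h : Algebra.norm ℤ ((ℓ : ℤ) • (1 : 𝓞 K)) = (ℓ : ℤ) ^ finrank ℚ K := by
    rw [Algebra.smul_def, mul_one, Algebra.norm_algebraMap, NumberField.RingOfIntegers.rank]
  rw [zsmul_eq_mul, mul_one, Int.cast_natCast] at h
  rw [h, Int.natAbs_pow, Int.natAbs_natCast]

/-- **`#(𝓞_K/ℓ𝓞_K) = ℓ²`** for a quadratic field. [cite: Cox2013, §7.D (7.28) (|𝒪_K/ℓ𝒪_K| = ℓ²)] -/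
theorem natCard_quot_span_natCast (h2 : finrank ℚ K = 2) (ℓ : ℕ) :
    Nat.card (𝓞 K ⧸ Ideal.span {(ℓ : 𝓞 K)}) = ℓ ^ 2 := by
  rw [← Submodule.cardQuot_apply, ← Ideal.absNorm_apply, absNorm_span_natCast_eq_pow, h2]

/-- **`β^{ℓ²-1} ≡ 1 (mod ℓ𝓞_K)`** for an inert prime `ℓ` of a quadratic field (`ℓ𝓞_K` prime) and
`β` prime to `ℓ`: the residue field `𝓞_K/ℓ𝓞_K` has `ℓ²` elements.
[cite: GrossLMS1991, §3 (p. 239: 𝔽_λ = 𝓞_K/λ has ℓ² elements)] -/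
theorem pow_sub_one_mem_span_of_inert (h2 : finrank ℚ K = 2) {ℓ : ℕ} (hℓ : ℓ.Prime)
    (hℓP : (Ideal.span {(ℓ : 𝓞 K)}).IsPrime) {β : 𝓞 K}
    (hβ : Ideal.span {β} ⊔ Ideal.span {(ℓ : 𝓞 K)} = ⊤) :
    β ^ (ℓ ^ 2 - 1) - 1 ∈ Ideal.span {(ℓ : 𝓞 K)} := by
  classical
  have hne : Ideal.span {(ℓ : 𝓞 K)} ≠ ⊥ := by
    rw [Ne, Ideal.span_singleton_eq_bot]; exact_mod_cast hℓ.ne_zero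
  haveI hmax : (Ideal.span {(ℓ : 𝓞 K)}).IsMaximal := hℓP.isMaximal hne
  letI : Field (𝓞 K ⧸ Ideal.span {(ℓ : 𝓞 K)}) := Ideal.Quotient.field _
  haveI : Finite (𝓞 K ⧸ Ideal.span {(ℓ : 𝓞 K)}) := Ideal.finiteQuotientOfFreeOfNeBot _ hne
  letI : Fintype (𝓞 K ⧸ Ideal.span {(ℓ : 𝓞 K)}) := Fintype.ofFinite _
  have hcard : Fintype.card (𝓞 K ⧸ Ideal.span {(ℓ : 𝓞 K)}) = ℓ ^ 2 := by
    rw [← Nat.card_eq_fintype_card, natCard_quot_span_natCast h2]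
  have hβu : IsUnit (Ideal.Quotient.mk (Ideal.span {(ℓ : 𝓞 K)}) β) := isUnit_mk_of_sup_eq_top hβ
  have hβ0 : Ideal.Quotient.mk (Ideal.span {(ℓ : 𝓞 K)}) β ≠ 0 := hβu.ne_zero
  have key := FiniteField.pow_card_sub_one_eq_one (Ideal.Quotient.mk (Ideal.span {(ℓ : 𝓞 K)}) β) hβ0
  rw [hcard] at key
  rw [← Ideal.Quotient.eq, map_pow, map_one]
  exact key

/-! ### The divisibility `p^E ∣ orderOf [𝔭]` at inert prime conductor -/

omit [NumberField K] in
/-- An integer `a` prime to the prime `ℓ` has `a^{ℓ-1} ≡ 1 (mod ℓ𝓞_K)` (Fermat, pushed into `𝓞_K`).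
[folklore] -/
private theorem intCast_pow_sub_one_mem_span {ℓ : ℕ} (hℓ : ℓ.Prime) {a : ℤ} (ha : IsCoprime a (ℓ : ℤ)) :
    (a : 𝓞 K) ^ (ℓ - 1) - 1 ∈ Ideal.span {(ℓ : 𝓞 K)} := by
  have hF : a ^ (ℓ - 1) ≡ 1 [ZMOD (ℓ : ℤ)] := Int.ModEq.pow_card_sub_one_eq_one hℓ ha
  obtain ⟨k, hk⟩ := (Int.ModEq.dvd hF.symm)
  rw [Ideal.mem_span_singleton]
  refine ⟨(k : 𝓞 K), ?_⟩
  have := congrArg (fun z : ℤ => (z : 𝓞 K)) hk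
  push_cast at this
  linear_combination this

/-- Elementary: if `d ∣ m`, `d ∤ m / p` and `p^E ∣ m` (`p` prime) then `p^E ∣ d`. [folklore] -/
private theorem pow_dvd_of_dvd_of_not_dvd_div {p E m d : ℕ} (hp : p.Prime) (hdm : d ∣ m)
    (hnd : ¬ d ∣ m / p) (hpm : p ^ E ∣ m) : p ^ E ∣ d := by
  obtain ⟨k, rfl⟩ := hdm
  have hpk : ¬ p ∣ k := by
    rintro ⟨j, rfl⟩
    apply hnd
    refine ⟨j, ?_⟩
    rw [show d * (p * j) = d * j * p by ring, Nat.mul_div_cancel _ hp.pos]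
  exact (Nat.Coprime.pow_left E ((Nat.Prime.coprime_iff_not_dvd hp).mpr hpk)).dvd_of_dvd_mul_right hpm

/-- **`p^E ∣ orderOf [𝔭]` in the ring class group of inert PRIME conductor `ℓ`.** Let `K` be an
imaginary quadratic field with `d_K < -4`, `ℓ` a rational prime with `ℓ𝓞_K` prime (inert), `p` a
prime with `p^E ∣ ℓ + 1` and `p ∤ ℓ - 1`, `𝔭 = 𝔭_v ∤ ℓ` with `𝔭^h = (β)`, and suppose
`β^{(ℓ²-1)/p} ≢ 1 (mod ℓ𝓞_K)` (i.e. `β` is not a `p`-th power in `(𝓞_K/ℓ)^× ≅ 𝔽_{ℓ²}^×`). Then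
`p^E` divides the order of `[𝔭]` in `I_K(ℓ)/P_{K,ℤ}(ℓ)`. Proof: with `n = orderOf [𝔭]`,
`[𝔭]^{hn} = 1` gives `β^n ≡ ±a` (`exists_pow_sub_intCast_mem_of_primeClass_pow_eq_one`,
`𝓞_K^× = {±1}`), hence `β^{n(ℓ-1)} ≡ 1` (Fermat); the order `d` of `β mod ℓ` divides `n(ℓ-1)` and
`ℓ² - 1` but not `(ℓ²-1)/p`, so `p^E ∣ p^{v_p(ℓ²-1)} ∣ d ∣ n(ℓ - 1)` and `p ∤ ℓ - 1`.
(Gross 1991, §3: `(𝓞_K/ℓ)^×/(ℤ/ℓ)^×` is cyclic of order `ℓ+1`; Cox (7.27).)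
[cite: Cox2013, §7.D (7.27), Thm. 7.24] [cite: GrossLMS1991, §3 (p. 239)] -/
theorem pow_dvd_orderOf_primeClass_of_inert (h2 : finrank ℚ K = 2) (hd : NumberField.discr K < -4)
    {ℓ : ℕ} (hℓ : ℓ.Prime) (hℓP : (Ideal.span {(ℓ : 𝓞 K)}).IsPrime)
    {p E : ℕ} (hp : p.Prime) (hpE : p ^ E ∣ ℓ + 1) (hpℓ : ¬ p ∣ ℓ - 1)
    {v : HeightOneSpectrum (𝓞 K)} (hv : v.asIdeal ⊔ Ideal.span {(ℓ : 𝓞 K)} = ⊤)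
    {h : ℕ} {β : 𝓞 K} (hβ : v.asIdeal ^ h = Ideal.span {β})
    (hkum : β ^ ((ℓ ^ 2 - 1) / p) - 1 ∉ Ideal.span {(ℓ : 𝓞 K)}) :
    p ^ E ∣ orderOf (primeClass ℓ v) := by
  classical
  set n := orderOf (primeClass ℓ v) with hn_def
  -- `[𝔭]^{h n} = 1`
  have hn1 : primeClass ℓ v ^ (h * n) = 1 := by rw [pow_mul', pow_orderOf_eq_one, one_pow]
  obtain ⟨ε, a, ha, hεa⟩ :=
    exists_pow_sub_intCast_mem_of_primeClass_pow_eq_one h2 hℓ.two_le hv hβ hn1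
  -- `ε = ±1`, so `β^n ≡ a'` with `a' = ±a ∈ ℤ` prime to `ℓ`
  obtain ⟨a', ha', hβa'⟩ : ∃ a' : ℤ, IsCoprime a' (ℓ : ℤ) ∧
      β ^ n - (a' : 𝓞 K) ∈ Ideal.span {(ℓ : 𝓞 K)} := by
    rcases CMTypeLattice.units_eq_one_or_eq_neg_one_of_discr_lt h2 hd ε with hε | hε
    · refine ⟨a, ha, ?_⟩
      simpa [hε] using hεa
    · refine ⟨-a, ha.neg_left, ?_⟩
      simpa [hε] using hεa
  -- work in `Q = 𝓞_K/ℓ`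
  set π := Ideal.Quotient.mk (Ideal.span {(ℓ : 𝓞 K)}) with hπ
  have hβn : π β ^ n = π (a' : 𝓞 K) := by
    rw [← map_pow, eq_comm, ← sub_eq_zero, ← map_sub, Ideal.Quotient.eq_zero_iff_mem]
    have : (a' : 𝓞 K) - β ^ n = -(β ^ n - (a' : 𝓞 K)) := by ring
    rw [this]
    exact Submodule.neg_mem _ hβa'
  have ha'F : π (a' : 𝓞 K) ^ (ℓ - 1) = 1 := by
    rw [← map_pow, ← π.map_one, Ideal.Quotient.eq]
    exact intCast_pow_sub_one_mem_span hℓ ha'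
  -- `(π β)^{n (ℓ-1)} = 1` and `(π β)^{ℓ²-1} = 1`, but `(π β)^{(ℓ²-1)/p} ≠ 1`
  have h1 : π β ^ (n * (ℓ - 1)) = 1 := by rw [pow_mul, hβn, ha'F]
  have h2' : π β ^ (ℓ ^ 2 - 1) = 1 := by
    rw [← map_pow, ← π.map_one, Ideal.Quotient.eq]
    exact pow_sub_one_mem_span_of_inert h2 hℓ hℓP (span_sup_eq_top_of_pow_eq_span hv hβ)
  have h3 : π β ^ ((ℓ ^ 2 - 1) / p) ≠ 1 := by
    rw [← map_pow, ← π.map_one, Ne, Ideal.Quotient.eq]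
    exact hkum
  -- the order `d` of `π β`
  set d := orderOf (π β) with hd_def
  have hd1 : d ∣ n * (ℓ - 1) := orderOf_dvd_of_pow_eq_one h1
  have hd2 : d ∣ ℓ ^ 2 - 1 := orderOf_dvd_of_pow_eq_one h2'
  have hd3 : ¬ d ∣ (ℓ ^ 2 - 1) / p := fun hdd ↦ h3 (orderOf_dvd_iff_pow_eq_one.mp hdd)
  have hsq : ℓ ^ 2 - 1 = (ℓ + 1) * (ℓ - 1) := by
    obtain ⟨k, rfl⟩ : ∃ k, ℓ = k + 1 := ⟨ℓ - 1, (Nat.sub_add_cancel hℓ.one_le).symm⟩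
    rw [Nat.add_sub_cancel]
    exact Nat.sub_eq_of_eq_add (by ring)
  have hpm : p ^ E ∣ ℓ ^ 2 - 1 := hsq ▸ hpE.mul_right (ℓ - 1)
  have hpd : p ^ E ∣ d := pow_dvd_of_dvd_of_not_dvd_div hp hd2 hd3 hpm
  have hpn : p ^ E ∣ n * (ℓ - 1) := hpd.trans hd1
  exact (Nat.Coprime.pow_left E ((Nat.Prime.coprime_iff_not_dvd hp).mpr hpℓ)).dvd_of_dvd_mul_right hpn

end Literature.NumberTheory.QuadraticFields.RingClass

end
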